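import Literature.MathematicalPhysics.QuantumFieldTheory.Balaban1983to89.B9Eq315QLipschitz
import Literature.MathematicalPhysics.QuantumFieldTheory.Balaban1983to89.B8Ineq159FlatMaps
import Literature.MathematicalPhysics.QuantumFieldTheory.Balaban1983to89.B8Eq138LandauZd
import Literature.MathematicalPhysics.QuantumFieldTheory.Balaban1983to89.B7Prop3GeneralRotated

/-!
# `Balaban1983to89.B8Ineq159StencilsNearFlat` — [Balaban1985RegularSpaces] (1.1) p. 76, (1.38) p. 82, (1.55) p. 86 ∕ [Balaban1985BackgroundPropagators]
# (3.4) p. 391, (3.19) p. 393, (3.23)–(3.24) p. 394 ∕ [Balaban1985Averaging] (122)–(126) p. 36: THE STENCILS OF THE (1.59) DATA AT A BACKGROUND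
# `U₀` WITH `‖U₀(b) − 1‖ ≤ δ` AGAINST THE FLAT ONES — explicit `O(δ)` differences for `D^η_{U₀}`, `D^{η*}_{U₀}`, the plaquette derivative, the current
# `J_{U₀} = D^{η*}_{U₀}D^η_{U₀}`, the Laplacian `Δ^η_{U₀}`, the Landau stencil `Δ^η_{U₀}𝟙_{Ω₀}D^{η*}_{U₀}`, the level-one transpose `Q′(U₀)ᵀ` and the level-one
# linearised average `L·Q₁(U₀)` (file (C) of the per-member curved (1.59))

statement-level skeleton of published theorems with citation tags; proofs where landed; nothing here is a claim about the
Yang–Mills mass gap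

`[Balaban1985RegularSpaces]` ("B8", CMP **99** (1985) 75–102) (1.1) p. 76, (1.38) p. 82, (1.55) p. 86, (1.59) p. 86; [4] =
`[Balaban1985BackgroundPropagators]` (CMP **99** (1985) 389–434) (3.4) p. 391, (3.19) p. 393, (3.23)–(3.24) p. 394, (3.79) p. 406; [B7] =
`[Balaban1985Averaging]` (CMP **98** (1985) 17–51) (9) p. 18, p. 25, (56) p. 27, (78)–(80) p. 30, (122)–(126) p. 36.

CITATION HEADER (lean-in-tree rule).  Cell `pub-ymgap` (YM Track A, HUMAN RULING D-0062 ∕ D-0149), DAG node N05 = [B8], width seat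
`pub-ymgap-dag-n05-w3` (g2), CLAIM-1 file (C).  WHY.  The per-member curved (1.59) (CLAIM-1 file (D)) compares the data of a field `φ` at a
background `U₀` near `1` — the Landau stencil of (1.38) `Δ^η_{U₀}(𝟙_{□₀}D^{η*}_{U₀}φ) − Q′(U₀)ᵀμ`, the current `J_{U₀}φ`, the averages `Q_j(U₀)(iηφ)` — with
the flat data, to which the residual-tolerant flat estimate (file (B)) applies.  THIS FILE supplies the comparisons: every stencil is a finite sum of
terms `R(u)Z` with `u` a product of at most `dL` bond variables of `U₀`, and `‖R(u)Z − Z‖ ≤ 2‖u − 1‖‖Z‖` ([B7] p. 36 «the operators … are equal to 1 for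
z = 0»; `B8Eq143PlaqExpansion.norm_conjR_sub_self_le`), `‖U₀(Γ) − 1‖ ≤ |Γ|δ` (`B9Eq315QLipschitz.norm_hol_sub_one_le`).  The level-one linearised
average is `B9Eq315QLipschitz.norm_linQcov_sub_flat_le_of_bonds` ((126) ∕ [4] (3.79): «Lipschitz in the background at V₀ = 1») BY NAME.  The averaging
TOWER (levels `j ≥ 2`: transporters of the averaged backgrounds `Ū₀ʲ`, [B7] (43)) is NOT treated here — the first edition of (D) sits at truncation
`m = 1`, where (1.29)∕(1.38)'s transpose and (1.31)'s averages are one-step.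

THE MATHEMATICS (kernel-checked; `U₀ ∈ U1` bondwise, `‖U₀(b) − 1‖ ≤ δ` on all of `ℤᵈ`, `η > 0`).
* §1 `D^η_{U₀,μ} − D^η_{1,μ}`, `D^{η*}_{U₀,ν} − D^{η*}_{1,ν}` (`2η⁻¹δ‖f‖`), bounds of `D^η_{U₀}`, `D^{η*}_{U₀}` (`2η⁻¹‖f‖∞`); the plaquette derivative (3.4)
  (`4η⁻¹δ‖A‖∞`), `pdiv` (`2dη⁻¹·`), ★ the current `‖J_{U₀}A − J_1A‖ ≤ 32dη⁻²δ‖A‖∞`; the divergence on bond fields (`2dη⁻¹δ‖A‖∞`), the Laplacian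
  (`8dη⁻²δ‖g‖∞`), ★ the Landau stencil `‖Δ^η_{U₀}(𝟙_SD^{η*}_{U₀}A) − Δ^η_1(𝟙_SD^{η*}_1A)‖ ≤ 24d²η⁻³δ‖A‖∞`.
* §2 the level-one transpose: `‖U₀(Γ_{Ly,x}) − 1‖ ≤ dLδ` on a block contour, ★ `‖Q′(U₀)ᵀμ − Q′(1)ᵀμ‖ ≤ 2dL·L^{−d}·δ·sup_{Λ₁}‖μ₁‖` at truncation `1`.
* §3 the level-one average: ★ `‖LQ₁(U₀)B − LQ₁(1)B‖ ≤ 102(d+1)²L²δ‖B‖∞` for `128(d+1)Lδ ≤ 1` (n/a at level `0`, where both are `B`).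

HONEST SCOPE.  Elementary telescoping around `1`; explicit but crude constants; background-closeness is assumed on ALL bonds of `ℤᵈ` (no locality
bookkeeping); the averaging tower `j ≥ 2` is not here; nothing of [4] Thm 3.3; count-neutral; N05 NOT discharged; no count claim; one finite `𝕋⁴` programme
at fixed `ε`, Bałaban as printed; the YM mass gap (Clay) is NOT proved by any of this — R4 closes the conditional finite-`𝕋⁴` rung `BalabanLadder.UV` only;
nothing continuum ∕ ℝ⁴ ∕ OS.  No `sorry`, no `def`, no `instance`, no `notation`.  Unit `pub-ymgap-dag-n05-w3` (g2), 2026-08-28.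
-/

noncomputable section

namespace Literature.MathematicalPhysics.QuantumFieldTheory.Balaban1983to89.B8Ineq159StencilsNearFlat

open B7Prop1Explicit B7Prop2Explicit B7Prop1Local
open B7Eq78Linearization (conjR conjR_apply)
open B7Prop4GeneralLevels (linCovIter linCovIter_succ)
open B7Prop3GeneralLinear (linQcov)
open B7Prop3GeneralRotated (norm_conjR_le)
open B8Ineq132 (covDerivFwd covDeriv)
open B8Eq143PlaqExpansion (pdiv norm_conjR_sub_self_le)
open B8Eq146AExpansion (plaqCovDeriv plaqCovDeriv_eq_covDerivFwd)
open B8Eq155JBound (Jcur)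
open B8Eq138LandauZd (covDivB covLap qprimeT1 QprimeT QT)
open B8Eq119TwistedAxial (bgT bgT_one)
open B8Eq191FlatStencils (covDerivFwd_flat_apply covDeriv_flat_apply qprimeT1_flat_apply conjR_unitOne conjR_unitOne_inv)
open B9Eq315QLipschitz (norm_hol_sub_one_le norm_Wcx_sub_one_le norm_linQcov_sub_flat_le_of_bonds)
open Literature.MathematicalPhysics.QuantumLattice (blockMap blockBase)

export B7Prop1Explicit (Site)

variable {d : ℕ} {𝔸 : Type*} [NormedRing 𝔸] [NormOneClass 𝔸] [NormedAlgebra ℂ 𝔸] [CompleteSpace 𝔸]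

variable {U₀ : Site d → Fin d → 𝔸ˣ} (hU : ∀ x κ, U₀ x κ ∈ U1 𝔸) {δ : ℝ} (hδ : ∀ x κ, ‖((U₀ x κ : 𝔸ˣ) : 𝔸) - 1‖ ≤ δ)

/-! ## §1 The local stencils -/

section Local

omit [NormOneClass 𝔸] [CompleteSpace 𝔸] in
/-- `D^η_{V,μ}` is additive in the field (bookkeeping). [folklore] -/
private theorem covDerivFwd_sub'' (η : ℝ) (V : Site d → Fin d → 𝔸ˣ) (μ : Fin d) (f g : Site d → 𝔸) (x : Site d) :
    covDerivFwd η V μ (f - g) x = covDerivFwd η V μ f x - covDerivFwd η V μ g x := by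
  simp only [covDerivFwd, Pi.sub_apply, B7Eq78Linearization.conjR_sub, ← smul_sub]
  congr 1; abel

omit [NormOneClass 𝔸] [CompleteSpace 𝔸] in
/-- `D^{η*}_{V,ν}` is additive in the field (bookkeeping). [folklore] -/
private theorem covDeriv_sub'' (η : ℝ) (V : Site d → Fin d → 𝔸ˣ) (ν : Fin d) (f g : Site d → 𝔸) (x : Site d) :
    covDeriv η V ν (f - g) x = covDeriv η V ν f x - covDeriv η V ν g x := by
  simp only [covDeriv, Pi.sub_apply, B7Eq78Linearization.conjR_sub, ← smul_sub]
  congr 1; abel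

omit [NormOneClass 𝔸] [CompleteSpace 𝔸] in
/-- `D^{η*}_V` on bond fields is additive (bookkeeping). [folklore] -/
private theorem covDivB_sub'' (η : ℝ) (V : Site d → Fin d → 𝔸ˣ) (A B : Site d → Fin d → 𝔸) (x : Site d) :
    covDivB η V (A - B) x = covDivB η V A x - covDivB η V B x := by
  simp only [covDivB, ← Finset.sum_sub_distrib]
  refine Finset.sum_congr rfl fun ν _ => ?_
  rw [← covDeriv_sub'']
  rfl

omit [NormOneClass 𝔸] [CompleteSpace 𝔸] in
/-- `Δ^η_V` is additive (bookkeeping). [folklore] -/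
private theorem covLap_sub'' (η : ℝ) (V : Site d → Fin d → 𝔸ˣ) (f g : Site d → 𝔸) (x : Site d) :
    covLap η V (f - g) x = covLap η V f x - covLap η V g x := by
  unfold covLap
  rw [← covDivB_sub'']
  congr 1
  funext z μ
  exact covDerivFwd_sub'' η V μ f g z

omit [CompleteSpace 𝔸] in
include hU hδ in
/-- **`‖D^η_{U₀,μ}f(x) − D^η_{1,μ}f(x)‖ ≤ η⁻¹·2δ·‖f(x + e_μ)‖`** — `D^η_{U₀,μ}f − D^η_{1,μ}f = η⁻¹(R(U₀(b))f(x+e_μ) − f(x+e_μ))`.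
[cite: Balaban1985RegularSpaces, (1.1) p.76; Balaban1985Averaging, (56) p.27, p.36] -/
theorem norm_covDerivFwd_sub_flat_le {η : ℝ} (hη : 0 < η) (μ : Fin d) (f : Site d → 𝔸) (x : Site d) :
    ‖covDerivFwd η U₀ μ f x - covDerivFwd η (1 : Site d → Fin d → 𝔸ˣ) μ f x‖ ≤ η⁻¹ * (2 * δ * ‖f (x + e μ)‖) := by
  have h : covDerivFwd η U₀ μ f x - covDerivFwd η (1 : Site d → Fin d → 𝔸ˣ) μ f x =
      η⁻¹ • (conjR (U₀ x μ) (f (x + e μ)) - f (x + e μ)) := by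
    simp only [covDerivFwd, Pi.one_apply, conjR_unitOne, ← smul_sub, sub_sub_sub_cancel_right]
  rw [h, norm_smul, Real.norm_of_nonneg (inv_nonneg.2 hη.le)]
  refine mul_le_mul_of_nonneg_left ?_ (inv_nonneg.2 hη.le)
  exact (norm_conjR_sub_self_le (hU x μ) _).trans (by gcongr; exact hδ x μ)

omit [CompleteSpace 𝔸] in
include hU hδ in
/-- **`‖D^{η*}_{U₀,ν}f(x) − D^{η*}_{1,ν}f(x)‖ ≤ η⁻¹·2δ·‖f(x − e_ν)‖`** (`‖u⁻¹ − 1‖ ≤ ‖u − 1‖` on `U1`). [cite: Balaban1985RegularSpaces, (1.1) p.76; Balaban1985Averaging, (56) p.27] -/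
theorem norm_covDeriv_sub_flat_le {η : ℝ} (hη : 0 < η) (ν : Fin d) (f : Site d → 𝔸) (x : Site d) :
    ‖covDeriv η U₀ ν f x - covDeriv η (1 : Site d → Fin d → 𝔸ˣ) ν f x‖ ≤ η⁻¹ * (2 * δ * ‖f (x - e ν)‖) := by
  have h : covDeriv η U₀ ν f x - covDeriv η (1 : Site d → Fin d → 𝔸ˣ) ν f x =
      η⁻¹ • (conjR (U₀ (x - e ν) ν)⁻¹ (f (x - e ν)) - f (x - e ν)) := by
    simp only [covDeriv, Pi.one_apply, conjR_unitOne_inv, ← smul_sub, sub_sub_sub_cancel_right]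
  rw [h, norm_smul, Real.norm_of_nonneg (inv_nonneg.2 hη.le)]
  refine mul_le_mul_of_nonneg_left ?_ (inv_nonneg.2 hη.le)
  have hinv : ‖(((U₀ (x - e ν) ν)⁻¹ : 𝔸ˣ) : 𝔸) - 1‖ ≤ δ := (norm_inv_sub_one_le (hU _ _)).trans (hδ _ _)
  exact (norm_conjR_sub_self_le ((U1 𝔸).inv_mem (hU _ _)) _).trans (by gcongr)

omit [CompleteSpace 𝔸] in
include hU in
/-- `‖D^η_{U₀,μ}f(x)‖ ≤ η⁻¹(‖f(x+e_μ)‖ + ‖f(x)‖)` (`R(u)` contracts on `U1`). [cite: Balaban1985RegularSpaces, (1.1) p.76] -/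
theorem norm_covDerivFwd_le {η : ℝ} (hη : 0 < η) (μ : Fin d) (f : Site d → 𝔸) (x : Site d) :
    ‖covDerivFwd η U₀ μ f x‖ ≤ η⁻¹ * (‖f (x + e μ)‖ + ‖f x‖) := by
  unfold covDerivFwd
  rw [norm_smul, Real.norm_of_nonneg (inv_nonneg.2 hη.le)]
  exact mul_le_mul_of_nonneg_left ((norm_sub_le _ _).trans (add_le_add (norm_conjR_le (hU x μ) _) le_rfl))
    (inv_nonneg.2 hη.le)

omit [CompleteSpace 𝔸] in
include hU in
/-- `‖D^{η*}_{U₀,ν}f(x)‖ ≤ η⁻¹(‖f(x−e_ν)‖ + ‖f(x)‖)`. [cite: Balaban1985RegularSpaces, (1.1) p.76] -/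
theorem norm_covDeriv_le {η : ℝ} (hη : 0 < η) (ν : Fin d) (f : Site d → 𝔸) (x : Site d) :
    ‖covDeriv η U₀ ν f x‖ ≤ η⁻¹ * (‖f (x - e ν)‖ + ‖f x‖) := by
  unfold covDeriv
  rw [norm_smul, Real.norm_of_nonneg (inv_nonneg.2 hη.le)]
  exact mul_le_mul_of_nonneg_left ((norm_sub_le _ _).trans
    (add_le_add (norm_conjR_le ((U1 𝔸).inv_mem (hU _ _)) _) le_rfl)) (inv_nonneg.2 hη.le)

omit [CompleteSpace 𝔸] in
include hU hδ in
/-- **The plaquette derivative (3.4) near flat**: `‖(D^η_{U₀}A)(p) − (D^η_1A)(p)‖ ≤ η⁻¹·4δ·‖A‖∞`. [cite: Balaban1985BackgroundPropagators, (3.4) p.391] -/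
theorem norm_plaqCovDeriv_sub_flat_le {η : ℝ} (hη : 0 < η) {A : Site d → Fin d → 𝔸} {a : ℝ} (hA : ∀ z κ, ‖A z κ‖ ≤ a)
    (μ ν : Fin d) (x : Site d) :
    ‖plaqCovDeriv η U₀ A μ ν x - plaqCovDeriv η (1 : Site d → Fin d → 𝔸ˣ) A μ ν x‖ ≤ η⁻¹ * (4 * δ * a) := by
  have hδ0 : 0 ≤ δ := (norm_nonneg _).trans (hδ x μ)
  rw [plaqCovDeriv_eq_covDerivFwd, plaqCovDeriv_eq_covDerivFwd, sub_sub_sub_comm]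
  refine (norm_sub_le _ _).trans ?_
  have h1 := norm_covDerivFwd_sub_flat_le hU hδ hη μ (fun y => A y ν) x
  have h2 := norm_covDerivFwd_sub_flat_le hU hδ hη ν (fun y => A y μ) x
  have h1' : η⁻¹ * (2 * δ * ‖A (x + e μ) ν‖) ≤ η⁻¹ * (2 * δ * a) := by gcongr; exact hA _ _
  have h2' : η⁻¹ * (2 * δ * ‖A (x + e ν) μ‖) ≤ η⁻¹ * (2 * δ * a) := by gcongr; exact hA _ _
  calc ‖covDerivFwd η U₀ μ (fun y => A y ν) x - covDerivFwd η 1 μ (fun y => A y ν) x‖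
        + ‖covDerivFwd η U₀ ν (fun y => A y μ) x - covDerivFwd η 1 ν (fun y => A y μ) x‖
      ≤ η⁻¹ * (2 * δ * a) + η⁻¹ * (2 * δ * a) := add_le_add (h1.trans h1') (h2.trans h2')
    _ = η⁻¹ * (4 * δ * a) := by ring

omit [CompleteSpace 𝔸] in
include hU in
/-- `‖(D^η_{U₀}A)(p)‖ ≤ 4η⁻¹‖A‖∞`. [cite: Balaban1985BackgroundPropagators, (3.4) p.391] -/
theorem norm_plaqCovDeriv_le {η : ℝ} (hη : 0 < η) {A : Site d → Fin d → 𝔸} {a : ℝ} (hA : ∀ z κ, ‖A z κ‖ ≤ a)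
    (μ ν : Fin d) (x : Site d) : ‖plaqCovDeriv η U₀ A μ ν x‖ ≤ η⁻¹ * (4 * a) := by
  rw [plaqCovDeriv_eq_covDerivFwd]
  refine (norm_sub_le _ _).trans ?_
  have h1 := norm_covDerivFwd_le hU hη μ (fun y => A y ν) x
  have h2 := norm_covDerivFwd_le hU hη ν (fun y => A y μ) x
  calc ‖covDerivFwd η U₀ μ (fun y => A y ν) x‖ + ‖covDerivFwd η U₀ ν (fun y => A y μ) x‖
      ≤ η⁻¹ * (a + a) + η⁻¹ * (a + a) :=
        add_le_add (h1.trans (by gcongr <;> exact hA _ _)) (h2.trans (by gcongr <;> exact hA _ _))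
    _ = η⁻¹ * (4 * a) := by ring

omit [NormOneClass 𝔸] [CompleteSpace 𝔸] in
/-- `pdiv` is a difference of two sums over at most `d` directions: a termwise bound `t` gives `‖pdiv‖ ≤ d·t + d·t`. [folklore] -/
private theorem norm_pdiv_le_of_termwise {η : ℝ} {V : Site d → Fin d → 𝔸ˣ} {F : Fin d → Fin d → Site d → 𝔸} {μ : Fin d} {x : Site d}
    {t : ℝ} (ht : 0 ≤ t) (h1 : ∀ ν, ‖covDeriv η V ν (F ν μ) x‖ ≤ t) (h2 : ∀ ν, ‖covDeriv η V ν (F μ ν) x‖ ≤ t) :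
    ‖pdiv η V F μ x‖ ≤ d * t + d * t := by
  unfold pdiv
  refine (norm_sub_le _ _).trans (add_le_add ?_ ?_)
  · refine (norm_sum_le _ _).trans ((Finset.sum_le_sum fun ν _ => h1 ν).trans ?_)
    rw [Finset.sum_const, nsmul_eq_mul]
    exact mul_le_mul_of_nonneg_right (by exact_mod_cast (Finset.card_le_univ _).trans (by simp)) ht
  · refine (norm_sum_le _ _).trans ((Finset.sum_le_sum fun ν _ => h2 ν).trans ?_)
    rw [Finset.sum_const, nsmul_eq_mul]
    exact mul_le_mul_of_nonneg_right (by exact_mod_cast (Finset.card_le_univ _).trans (by simp)) ht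

omit [NormOneClass 𝔸] [CompleteSpace 𝔸] in
/-- `pdiv` is additive in the plaquette field (bookkeeping; cf. `B8Eq143PlaqExpansion.pdiv_add`). [folklore] -/
private theorem pdiv_sub' (η : ℝ) (V : Site d → Fin d → 𝔸ˣ) (F G : Fin d → Fin d → Site d → 𝔸) (μ : Fin d) (x : Site d) :
    pdiv η V (F - G) μ x = pdiv η V F μ x - pdiv η V G μ x := by
  have e1 : ∀ ν, covDeriv η V ν ((F - G) ν μ) x = covDeriv η V ν (F ν μ) x - covDeriv η V ν (G ν μ) x :=
    fun ν => covDeriv_sub'' η V ν (F ν μ) (G ν μ) x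
  have e2 : ∀ ν, covDeriv η V ν ((F - G) μ ν) x = covDeriv η V ν (F μ ν) x - covDeriv η V ν (G μ ν) x :=
    fun ν => covDeriv_sub'' η V ν (F μ ν) (G μ ν) x
  unfold pdiv
  simp only [e1, e2, Finset.sum_sub_distrib]
  abel

omit [CompleteSpace 𝔸] in
include hU hδ in
/-- ★ **THE CURRENT (1.55) NEAR FLAT**: `‖J_{U₀}(A)_μ(x) − J_1(A)_μ(x)‖ ≤ 32d·η⁻²·δ·‖A‖∞` — `J_{U₀}A − J_1A = D^{η*}_{U₀}(D^η_{U₀}A − D^η_1A) +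
(D^{η*}_{U₀} − D^{η*}_1)(D^η_1A)`, each covariant derivative a conjugation stencil. [cite: Balaban1985RegularSpaces, (1.55) p.86, (1.2) p.76; Balaban1985BackgroundPropagators, (3.4) p.391] -/
theorem norm_Jcur_sub_flat_le {η : ℝ} (hη : 0 < η) {A : Site d → Fin d → 𝔸} {a : ℝ} (ha : 0 ≤ a) (hA : ∀ z κ, ‖A z κ‖ ≤ a)
    (μ : Fin d) (x : Site d) :
    ‖Jcur η U₀ A μ x - Jcur η (1 : Site d → Fin d → 𝔸ˣ) A μ x‖ ≤ 32 * d * (η ^ 2)⁻¹ * δ * a := by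
  have hδ0 : 0 ≤ δ := (norm_nonneg _).trans (hδ x μ)
  have hηne : η ≠ 0 := hη.ne'
  have hη0 : 0 ≤ η⁻¹ := inv_nonneg.2 hη.le
  have hd : (0 : ℝ) ≤ d := Nat.cast_nonneg d
  have h1U : ∀ x κ, (1 : Site d → Fin d → 𝔸ˣ) x κ ∈ U1 𝔸 := fun _ _ => (U1 𝔸).one_mem
  -- split
  have hsplit : Jcur η U₀ A μ x - Jcur η (1 : Site d → Fin d → 𝔸ˣ) A μ x =
      pdiv η U₀ (plaqCovDeriv η U₀ A - plaqCovDeriv η (1 : Site d → Fin d → 𝔸ˣ) A) μ x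
        + (pdiv η U₀ (plaqCovDeriv η (1 : Site d → Fin d → 𝔸ˣ) A) μ x
            - pdiv η (1 : Site d → Fin d → 𝔸ˣ) (plaqCovDeriv η (1 : Site d → Fin d → 𝔸ˣ) A) μ x) := by
    rw [B8Eq155JBound.Jcur_def, B8Eq155JBound.Jcur_def, pdiv_sub']; abel
  -- the two pieces
  have hP : ∀ κ κ' z, ‖(plaqCovDeriv η U₀ A - plaqCovDeriv η (1 : Site d → Fin d → 𝔸ˣ) A) κ κ' z‖ ≤ η⁻¹ * (4 * δ * a) :=
    fun κ κ' z => norm_plaqCovDeriv_sub_flat_le hU hδ hη hA κ κ' z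
  have hP1 : ∀ κ κ' z, ‖plaqCovDeriv η (1 : Site d → Fin d → 𝔸ˣ) A κ κ' z‖ ≤ η⁻¹ * (4 * a) :=
    fun κ κ' z => norm_plaqCovDeriv_le h1U hη hA κ κ' z
  have hT1 : ∀ ν κ κ', ‖covDeriv η U₀ ν ((plaqCovDeriv η U₀ A - plaqCovDeriv η (1 : Site d → Fin d → 𝔸ˣ) A) κ κ') x‖ ≤
      η⁻¹ * (η⁻¹ * (4 * δ * a) + η⁻¹ * (4 * δ * a)) :=
    fun ν κ κ' => (norm_covDeriv_le hU hη ν _ x).trans (by gcongr <;> exact hP _ _ _)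
  have hT2 : ∀ ν κ κ', ‖covDeriv η U₀ ν (plaqCovDeriv η (1 : Site d → Fin d → 𝔸ˣ) A κ κ') x
      - covDeriv η (1 : Site d → Fin d → 𝔸ˣ) ν (plaqCovDeriv η (1 : Site d → Fin d → 𝔸ˣ) A κ κ') x‖ ≤ η⁻¹ * (2 * δ * (η⁻¹ * (4 * a))) :=
    fun ν κ κ' => (norm_covDeriv_sub_flat_le hU hδ hη ν _ x).trans (by gcongr; exact hP1 _ _ _)
  have hA1 : ‖pdiv η U₀ (plaqCovDeriv η U₀ A - plaqCovDeriv η (1 : Site d → Fin d → 𝔸ˣ) A) μ x‖ ≤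
      d * (η⁻¹ * (η⁻¹ * (4 * δ * a) + η⁻¹ * (4 * δ * a))) + d * (η⁻¹ * (η⁻¹ * (4 * δ * a) + η⁻¹ * (4 * δ * a))) :=
    norm_pdiv_le_of_termwise (by positivity) (fun ν => hT1 ν ν μ) (fun ν => hT1 ν μ ν)
  have hA2 : ‖pdiv η U₀ (plaqCovDeriv η (1 : Site d → Fin d → 𝔸ˣ) A) μ x
      - pdiv η (1 : Site d → Fin d → 𝔸ˣ) (plaqCovDeriv η (1 : Site d → Fin d → 𝔸ˣ) A) μ x‖ ≤
      d * (η⁻¹ * (2 * δ * (η⁻¹ * (4 * a)))) + d * (η⁻¹ * (2 * δ * (η⁻¹ * (4 * a)))) := by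
    have hsub : pdiv η U₀ (plaqCovDeriv η (1 : Site d → Fin d → 𝔸ˣ) A) μ x
        - pdiv η (1 : Site d → Fin d → 𝔸ˣ) (plaqCovDeriv η (1 : Site d → Fin d → 𝔸ˣ) A) μ x =
        (∑ ν ∈ Finset.Iio μ, (covDeriv η U₀ ν (plaqCovDeriv η 1 A ν μ) x - covDeriv η 1 ν (plaqCovDeriv η 1 A ν μ) x))
          - ∑ ν ∈ Finset.Ioi μ, (covDeriv η U₀ ν (plaqCovDeriv η 1 A μ ν) x - covDeriv η 1 ν (plaqCovDeriv η 1 A μ ν) x) := by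
      simp only [pdiv, Finset.sum_sub_distrib]; abel
    rw [hsub]
    refine (norm_sub_le _ _).trans (add_le_add ?_ ?_)
    · refine (norm_sum_le _ _).trans ((Finset.sum_le_sum fun ν _ => hT2 ν ν μ).trans ?_)
      rw [Finset.sum_const, nsmul_eq_mul]
      exact mul_le_mul_of_nonneg_right (by exact_mod_cast (Finset.card_le_univ _).trans (by simp)) (by positivity)
    · refine (norm_sum_le _ _).trans ((Finset.sum_le_sum fun ν _ => hT2 ν μ ν).trans ?_)
      rw [Finset.sum_const, nsmul_eq_mul]
      exact mul_le_mul_of_nonneg_right (by exact_mod_cast (Finset.card_le_univ _).trans (by simp)) (by positivity)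
  rw [hsplit]
  refine (norm_add_le _ _).trans ((add_le_add hA1 hA2).trans (le_of_eq ?_))
  field_simp
  ring

omit [CompleteSpace 𝔸] in
include hU hδ in
/-- **The divergence `D^{η*}_{U₀}` on bond fields (1.38) near flat**: `‖D^{η*}_{U₀}A(x) − D^{η*}_1A(x)‖ ≤ 2d·η⁻¹·δ·‖A‖∞`. [cite: Balaban1985RegularSpaces, (1.38) p.82, (1.1) p.76] -/
theorem norm_covDivB_sub_flat_le {η : ℝ} (hη : 0 < η) (hδ0 : 0 ≤ δ) {A : Site d → Fin d → 𝔸} {a : ℝ} (hA : ∀ z κ, ‖A z κ‖ ≤ a)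
    (x : Site d) : ‖covDivB η U₀ A x - covDivB η (1 : Site d → Fin d → 𝔸ˣ) A x‖ ≤ 2 * d * η⁻¹ * δ * a := by
  unfold covDivB
  rw [← Finset.sum_sub_distrib]
  refine (norm_sum_le _ _).trans ?_
  have hterm : ∀ ν : Fin d, ‖covDeriv η U₀ ν (fun z => A z ν) x - covDeriv η (1 : Site d → Fin d → 𝔸ˣ) ν (fun z => A z ν) x‖
      ≤ η⁻¹ * (2 * δ * a) :=
    fun ν => (norm_covDeriv_sub_flat_le hU hδ hη ν _ x).trans (by gcongr; exact hA _ _)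
  refine (Finset.sum_le_sum fun ν _ => hterm ν).trans ?_
  rw [Finset.sum_const, Finset.card_univ, Fintype.card_fin, nsmul_eq_mul]
  exact le_of_eq (by ring)

omit [CompleteSpace 𝔸] in
include hU in
/-- `‖D^{η*}_{U₀}A(x)‖ ≤ 2d·η⁻¹·‖A‖∞`. [cite: Balaban1985RegularSpaces, (1.38) p.82, (1.1) p.76] -/
theorem norm_covDivB_le {η : ℝ} (hη : 0 < η) {A : Site d → Fin d → 𝔸} {a : ℝ} (hA : ∀ z κ, ‖A z κ‖ ≤ a) (x : Site d) :
    ‖covDivB η U₀ A x‖ ≤ 2 * d * η⁻¹ * a := by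
  unfold covDivB
  refine (norm_sum_le _ _).trans ?_
  have hterm : ∀ ν : Fin d, ‖covDeriv η U₀ ν (fun z => A z ν) x‖ ≤ η⁻¹ * (a + a) :=
    fun ν => (norm_covDeriv_le hU hη ν _ x).trans (by gcongr <;> exact hA _ _)
  refine (Finset.sum_le_sum fun ν _ => hterm ν).trans ?_
  rw [Finset.sum_const, Finset.card_univ, Fintype.card_fin, nsmul_eq_mul]
  exact le_of_eq (by ring)

omit [CompleteSpace 𝔸] in
include hU hδ in
/-- **The Laplacian (3.23) near flat**: `‖Δ^η_{U₀}g(x) − Δ^η_1g(x)‖ ≤ 8d·η⁻²·δ·‖g‖∞` (`Δ = D^{η*}D^η`: perturb each factor). [cite: Balaban1985BackgroundPropagators, (3.23) p.394] -/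
theorem norm_covLap_sub_flat_le {η : ℝ} (hη : 0 < η) (hδ0 : 0 ≤ δ) {g : Site d → 𝔸} {b : ℝ} (hg : ∀ z, ‖g z‖ ≤ b)
    (x : Site d) : ‖covLap η U₀ g x - covLap η (1 : Site d → Fin d → 𝔸ˣ) g x‖ ≤ 8 * d * (η ^ 2)⁻¹ * δ * b := by
  have hηne : η ≠ 0 := hη.ne'
  have hη0 : 0 ≤ η⁻¹ := inv_nonneg.2 hη.le
  have h1U : ∀ x κ, (1 : Site d → Fin d → 𝔸ˣ) x κ ∈ U1 𝔸 := fun _ _ => (U1 𝔸).one_mem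
  -- `Δ_U g − Δ_1 g = D*_U(∇_U g − ∇_1 g) + (D*_U − D*_1)(∇_1 g)`
  set GU : Site d → Fin d → 𝔸 := fun z μ => covDerivFwd η U₀ μ g z with hGU
  set G1 : Site d → Fin d → 𝔸 := fun z μ => covDerivFwd η (1 : Site d → Fin d → 𝔸ˣ) μ g z with hG1
  have hsplit : covLap η U₀ g x - covLap η (1 : Site d → Fin d → 𝔸ˣ) g x =
      covDivB η U₀ (GU - G1) x + (covDivB η U₀ G1 x - covDivB η (1 : Site d → Fin d → 𝔸ˣ) G1 x) := by
    rw [covDivB_sub'']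
    show covDivB η U₀ GU x - covDivB η 1 G1 x = _
    abel
  have hGUG1 : ∀ z μ, ‖(GU - G1) z μ‖ ≤ η⁻¹ * (2 * δ * b) := fun z μ => by
    simp only [hGU, hG1, Pi.sub_apply]
    exact (norm_covDerivFwd_sub_flat_le hU hδ hη μ g z).trans (by gcongr; exact hg _)
  have hG1b : ∀ z μ, ‖G1 z μ‖ ≤ η⁻¹ * (b + b) := fun z μ => by
    simp only [hG1]
    exact (norm_covDerivFwd_le h1U hη μ g z).trans (by gcongr <;> exact hg _)
  have hA : ‖covDivB η U₀ (GU - G1) x‖ ≤ 2 * d * η⁻¹ * (η⁻¹ * (2 * δ * b)) := norm_covDivB_le hU hη hGUG1 x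
  have hB : ‖covDivB η U₀ G1 x - covDivB η (1 : Site d → Fin d → 𝔸ˣ) G1 x‖ ≤ 2 * d * η⁻¹ * δ * (η⁻¹ * (b + b)) :=
    norm_covDivB_sub_flat_le hU hδ hη hδ0 hG1b x
  rw [hsplit]
  refine (norm_add_le _ _).trans ((add_le_add hA hB).trans (le_of_eq ?_))
  field_simp
  ring

omit [CompleteSpace 𝔸] in
include hU in
/-- `‖Δ^η_{U₀}g(x)‖ ≤ 4d·η⁻²·‖g‖∞`. [cite: Balaban1985BackgroundPropagators, (3.23) p.394] -/
theorem norm_covLap_le {η : ℝ} (hη : 0 < η) {g : Site d → 𝔸} {b : ℝ} (hg : ∀ z, ‖g z‖ ≤ b) (x : Site d) :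
    ‖covLap η U₀ g x‖ ≤ 4 * d * (η ^ 2)⁻¹ * b := by
  have hηne : η ≠ 0 := hη.ne'
  have hG : ∀ z μ, ‖covDerivFwd η U₀ μ g z‖ ≤ η⁻¹ * (b + b) :=
    fun z μ => (norm_covDerivFwd_le hU hη μ g z).trans (by gcongr <;> exact hg _)
  refine (norm_covDivB_le hU hη hG x).trans (le_of_eq ?_)
  field_simp
  ring

omit [CompleteSpace 𝔸] in
include hU hδ in
/-- ★ **THE LANDAU STENCIL OF (1.38) NEAR FLAT**: `‖Δ^η_{U₀}(𝟙_SD^{η*}_{U₀}A)(x) − Δ^η_1(𝟙_SD^{η*}_1A)(x)‖ ≤ 24d²·η⁻³·δ·‖A‖∞` —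
`= Δ^η_{U₀}(𝟙_S(D^{η*}_{U₀}A − D^{η*}_1A)) + (Δ^η_{U₀} − Δ^η_1)(𝟙_SD^{η*}_1A)`. [cite: Balaban1985RegularSpaces, (1.38) p.82; Balaban1985BackgroundPropagators, (3.23)–(3.25) p.394] -/
theorem norm_landauStencil_sub_flat_le {η : ℝ} (hη : 0 < η) (hδ0 : 0 ≤ δ) (S : Set (Site d)) {A : Site d → Fin d → 𝔸} {a : ℝ}
    (ha : 0 ≤ a) (hA : ∀ z κ, ‖A z κ‖ ≤ a) (x : Site d) :
    ‖covLap η U₀ (S.indicator (covDivB η U₀ A)) x - covLap η (1 : Site d → Fin d → 𝔸ˣ) (S.indicator (covDivB η (1 : Site d → Fin d → 𝔸ˣ) A)) x‖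
      ≤ 24 * d ^ 2 * (η ^ 3)⁻¹ * δ * a := by
  classical
  have hηne : η ≠ 0 := hη.ne'
  have hη0 : 0 ≤ η⁻¹ := inv_nonneg.2 hη.le
  have hd : (0 : ℝ) ≤ d := Nat.cast_nonneg d
  have h1U : ∀ x κ, (1 : Site d → Fin d → 𝔸ˣ) x κ ∈ U1 𝔸 := fun _ _ => (U1 𝔸).one_mem
  set hU' : Site d → 𝔸 := S.indicator (covDivB η U₀ A) with hhU
  set h1 : Site d → 𝔸 := S.indicator (covDivB η (1 : Site d → Fin d → 𝔸ˣ) A) with hh1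
  -- sup bounds
  have hind : ∀ (f : Site d → 𝔸) (c : ℝ), 0 ≤ c → (∀ z, ‖f z‖ ≤ c) → ∀ z, ‖S.indicator f z‖ ≤ c := by
    intro f c hc hf z
    by_cases hz : z ∈ S
    · rw [Set.indicator_of_mem hz]; exact hf z
    · rw [Set.indicator_of_notMem hz, norm_zero]; exact hc
  have hdiff : ∀ z, ‖(hU' - h1) z‖ ≤ 2 * d * η⁻¹ * δ * a := by
    intro z
    rw [Pi.sub_apply]
    by_cases hz : z ∈ S
    · simp only [hhU, hh1, Set.indicator_of_mem hz]
      exact norm_covDivB_sub_flat_le hU hδ hη hδ0 hA z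
    · simp only [hhU, hh1, Set.indicator_of_notMem hz, sub_self, norm_zero]
      positivity
  have h1b : ∀ z, ‖h1 z‖ ≤ 2 * d * η⁻¹ * a := hind _ _ (by positivity) (fun w => norm_covDivB_le h1U hη hA w)
  -- split `Δ_U hU' − Δ_1 h1 = Δ_U (hU' − h1) + (Δ_U h1 − Δ_1 h1)`
  have hlin : covLap η U₀ (hU' - h1) x = covLap η U₀ hU' x - covLap η U₀ h1 x := covLap_sub'' η U₀ hU' h1 x
  have hsplit : covLap η U₀ hU' x - covLap η (1 : Site d → Fin d → 𝔸ˣ) h1 x =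
      covLap η U₀ (hU' - h1) x + (covLap η U₀ h1 x - covLap η (1 : Site d → Fin d → 𝔸ˣ) h1 x) := by
    rw [hlin]; abel
  have hT1 : ‖covLap η U₀ (hU' - h1) x‖ ≤ 4 * d * (η ^ 2)⁻¹ * (2 * d * η⁻¹ * δ * a) := norm_covLap_le hU hη hdiff x
  have hT2 : ‖covLap η U₀ h1 x - covLap η (1 : Site d → Fin d → 𝔸ˣ) h1 x‖ ≤ 8 * d * (η ^ 2)⁻¹ * δ * (2 * d * η⁻¹ * a) :=
    norm_covLap_sub_flat_le hU hδ hη hδ0 h1b x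
  rw [hsplit]
  refine (norm_add_le _ _).trans ((add_le_add hT1 hT2).trans (le_of_eq ?_))
  field_simp
  ring

end Local

/-! ## §2 The level-one transpose `Q′(U₀)ᵀ` near flat (truncation `m = 1`) -/

section Transpose

/-- The tree contour from the base of the `L`-block of `x` to `x` has at most `dL` bonds. [cite: Balaban1985Averaging, (14) p.19, (78) p.30] -/
theorem l1_sub_blockBase_blockMap_le {L : ℕ} (hL : 1 ≤ L) (x : Site d) : l1 (x - blockBase L (blockMap L x)) ≤ d * L := by
  unfold l1
  have hL0 : (0 : ℤ) < L := by exact_mod_cast hL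
  calc ∑ κ, ((x - blockBase L (blockMap L x)) κ).natAbs ≤ ∑ _κ : Fin d, L := Finset.sum_le_sum fun κ _ => by
          have hrem : (x - blockBase L (blockMap L x)) κ = x κ % (L : ℤ) := by
            simp only [Pi.sub_apply, blockBase, blockMap]
            rw [Int.emod_def]
          rw [hrem]
          have h0 : 0 ≤ x κ % (L : ℤ) := Int.emod_nonneg _ hL0.ne'
          have h1 : x κ % (L : ℤ) < L := Int.emod_lt_of_pos _ hL0
          omega
    _ = d * L := by simp

include hU hδ in
/-- **The level-`0` block transporter near flat**: `‖U₀(Γ_{Ly,x}) − 1‖ ≤ dL·δ` for the tree contour from the base of the block of `x` (`|Γ| ≤ dL` bonds each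
`δ`-close to `1`, `B9Eq315QLipschitz.norm_hol_sub_one_le`). [cite: Balaban1985Averaging, (78)–(80) p.30, p.25; Balaban1985RegularSpaces, (1.29) p.81] -/
theorem norm_bgT_zero_sub_one_le {L : ℕ} (hL : 1 ≤ L) (hδ0 : 0 ≤ δ) (x : Site d) :
    ‖((bgT L U₀ 0 (blockMap L x) x : 𝔸ˣ) : 𝔸) - 1‖ ≤ d * L * δ := by
  unfold bgT axialFn
  rw [avgIter_zero]
  refine (norm_hol_sub_one_le hU hδ _ _).trans ?_
  rw [length_treeWord]
  exact mul_le_mul_of_nonneg_right (by exact_mod_cast l1_sub_blockBase_blockMap_le hL x) hδ0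

include hU hδ in
/-- **One step of the transpose near flat**: `‖(Q′(U₀)ᵀν)₀(x) − (Q′(1)ᵀν)₀(x)‖ ≤ L^{−d}·2dLδ·‖ν(y(x))‖` (level `0 → 1`).
[cite: Balaban1985BackgroundPropagators, (3.19) p.393, (3.24) p.394; Balaban1985Averaging, (56) p.27] -/
theorem norm_qprimeT1_zero_sub_flat_le {L : ℕ} (hL : 1 ≤ L) (hδ0 : 0 ≤ δ) (ν : Site d → 𝔸) (x : Site d) :
    ‖qprimeT1 L U₀ 0 ν x - qprimeT1 L (1 : Site d → Fin d → 𝔸ˣ) 0 ν x‖ ≤ ((L : ℝ) ^ d)⁻¹ * (2 * (d * L * δ) * ‖ν (blockMap L x)‖) := by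
  rw [qprimeT1_flat_apply]
  unfold qprimeT1
  rw [← smul_sub, norm_smul, Real.norm_of_nonneg (by positivity)]
  refine mul_le_mul_of_nonneg_left ?_ (by positivity)
  set u : 𝔸ˣ := bgT L U₀ 0 (blockMap L x) x with hu
  have hu1 : u ∈ U1 𝔸 := by
    rw [hu]; unfold bgT axialFn; exact hol_mem hU _ _
  have hinv : ‖((u⁻¹ : 𝔸ˣ) : 𝔸) - 1‖ ≤ d * L * δ := (norm_inv_sub_one_le hu1).trans (norm_bgT_zero_sub_one_le hU hδ hL hδ0 x)
  exact (norm_conjR_sub_self_le ((U1 𝔸).inv_mem hu1) _).trans (by gcongr)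

include hU hδ in
/-- ★ **THE TRANSPOSE `Q′(U₀)ᵀ` AT TRUNCATION `m = 1` NEAR FLAT**: `‖(Q′(U₀)ᵀμ)(x) − (Q′(1)ᵀμ)(x)‖ ≤ L^{−d}·2dL·δ·M₁` whenever `‖μ₁‖ ≤ M₁` on `Λ₁` — the
level-`0` term is background-free, the level-`1` term is one conjugation by a block transporter. [cite: Balaban1985BackgroundPropagators, (3.24) p.394, (3.19) p.393; Balaban1985RegularSpaces, (1.29) p.81, (1.38) p.82] -/
theorem norm_QT_one_sub_flat_le {L : ℕ} (hL : 1 ≤ L) (hδ0 : 0 ≤ δ) (Λs : ℕ → Set (Site d)) (μ : ℕ → Site d → 𝔸) {M₁ : ℝ} (hM₁ : 0 ≤ M₁)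
    (hμ : ∀ y ∈ Λs 1, ‖μ 1 y‖ ≤ M₁) (x : Site d) :
    ‖QT L 1 Λs U₀ μ x - QT L 1 Λs (1 : Site d → Fin d → 𝔸ˣ) μ x‖ ≤ ((L : ℝ) ^ d)⁻¹ * (2 * (d * L * δ) * M₁) := by
  classical
  have hQT : ∀ V : Site d → Fin d → 𝔸ˣ, QT L 1 Λs V μ x = (Λs 0).indicator (μ 0) x + qprimeT1 L V 0 ((Λs 1).indicator (μ 1)) x := by
    intro V
    simp only [QT, Finset.sum_range_succ, Finset.sum_range_zero, zero_add]
    rfl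
  rw [hQT, hQT, add_sub_add_left_eq_sub]
  refine (norm_qprimeT1_zero_sub_flat_le hU hδ hL hδ0 _ x).trans ?_
  gcongr
  by_cases hy : blockMap L x ∈ Λs 1
  · rw [Set.indicator_of_mem hy]; exact hμ _ hy
  · rw [Set.indicator_of_notMem hy, norm_zero]; exact hM₁

end Transpose

/-! ## §3 The level-one linearised average `L·Q₁(U₀)` near flat -/

section Average

include hU hδ in
/-- ★ **THE LINEARISED AVERAGES UP TO LEVEL ONE NEAR FLAT**: for `128(d+1)Lδ ≤ 1` and `‖B‖ ≤ b`, `‖L·Q_j(U₀)B(c) − L·Q_j(1)B(c)‖ ≤ 102(d+1)²L²δ·b` for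
`j ≤ 1` — level `0` is the identity, level `1` is ONE step `L(Q(U₀)B)` whose Lipschitz modulus in the background at `1` is
`B9Eq315QLipschitz.norm_linQcov_sub_flat_le_of_bonds` (block loops `2(d+1)Lδ ≤ 1∕64`-regular by `norm_Wcx_sub_one_le`).
[cite: Balaban1985Averaging, (122)–(126) p.36, (127) p.37; Balaban1985BackgroundPropagators, (3.79) p.406; Balaban1985RegularSpaces, (1.31) p.82] -/
theorem norm_linCovIter_le_one_sub_flat_le {L : ℕ} (hL : 1 ≤ L) (hδ0 : 0 ≤ δ) (hsmall : 128 * ((d : ℝ) + 1) * L * δ ≤ 1)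
    {B : Site d → Fin d → 𝔸} {b : ℝ} (hb : 0 ≤ b) (hB : ∀ z κ, ‖B z κ‖ ≤ b) :
    ∀ j, j ≤ 1 → ∀ (z : Site d) (κ : Fin d),
      ‖linCovIter L U₀ B j z κ - linCovIter L (1 : Site d → Fin d → 𝔸ˣ) B j z κ‖ ≤ 102 * ((d : ℝ) + 1) ^ 2 * L ^ 2 * δ * b := by
  intro j hj z κ
  rcases Nat.lt_or_ge j 1 with h0 | h1
  · have : j = 0 := by omega
    subst this
    simp only [B7Prop4GeneralLevels.linCovIter_zero, sub_self, norm_zero]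
    positivity
  · have : j = 1 := le_antisymm hj h1
    subst this
    rw [linCovIter_succ, linCovIter_succ, B7Prop4GeneralLevels.linCovIter_zero, B7Prop4GeneralLevels.linCovIter_zero, avgIter_zero,
      avgIter_zero]
    have hα : 2 * ((d : ℝ) + 1) * L * δ ≤ 1 / 64 := by nlinarith
    have hW : ∀ r : Fin d → Fin L, ‖((Wcx L U₀ ((L : ℤ) • z) κ (boxVec L r) : 𝔸ˣ) : 𝔸) - 1‖ ≤ 2 * (d + 1) * L * δ :=
      fun r => norm_Wcx_sub_one_le hU hδ L _ κ r hδ0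
    refine (norm_linQcov_sub_flat_le_of_bonds L hU hδ hb hB hL ((L : ℤ) • z) κ hα hW hδ0).trans (le_of_eq ?_)
    ring

end Average

end Literature.MathematicalPhysics.QuantumFieldTheory.Balaban1983to89.B8Ineq159StencilsNearFlat

end
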